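import Mathlib
import HarnessLib
import Summits.SmoothPoincare4.Statement
import Summits.SmoothPoincare4.SmoothPoincare4.Theses.RootDecompN
import Literature.Topology.FourManifolds.ConnectedSum
import Literature.Topology.FourManifolds.ConnectedSumProofs
import Literature.Topology.FourManifolds.ComplexProjectiveSpace
import Literature.Topology.FourManifolds.HomotopyS4OrientableProofs
import Literature.Topology.FourManifolds.HomotopyS4CompactProofs
import Literature.Topology.FourManifolds.OrientedConnectedSumExistence
import Literature.Topology.FourManifolds.OrientedConnectedSumUniqueness
import Literature.Topology.FourManifolds.OrientedConnectedSumTransportProofs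
import Literature.Topology.FourManifolds.SmoothOrientationDiffeomorphProofs
import Literature.Topology.FourManifolds.SmoothOrientationConnectedProofs
import Literature.Topology.FourManifolds.HomotopySpheresProofs
import Literature.Topology.FourManifolds.ComplexProjectiveSpaceOrientationProofs
import Literature.Topology.FourManifolds.CerfTheoremOne
import Literature.Topology.FourManifolds.RadialExtension

/-! # RootDecompN — the split glue `BiDissolvableAmphichiralMirrorGlue` (item stmt-SmoothPoincare4-29363) PROVED.

`BiDissolvableAmphichiralMirrorGlue : ChiralityPinning → StableMirrorDescent → BiDissolvableAmphichiral` (route N rev 2,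
`--split BiDissolvableAmphichiral --into ChiralityPinning StableMirrorDescent`; lens-6 gen 6 «MIRROR DESCENT»).
Proof = lens-6 gen 6 `MirrorDescent.lean` §0–§4 (`biDissolvableAmphichiral_of_pin_smd`), transcribed and re-based on the born route
file with the lens's helper predicates (`PinnedChain`, `MirrorSymmetricAt`, `IsAmphichiral`) INLINED so that this Theorems file defines
no propositions:

* Theorem U `stdChain_unique` — two ORIENTED standard chains from `S⁴` with the same summands `(ℂℙ², c₀)` have
  orientation-preservingly diffeomorphic ends (Kervaire–Milnor 1963 Lemma 2.1 by induction, tree theorem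
  `exists_diffeomorph_isOrientationPreserving_of_isOrientedConnectedSum_euclidean`; base case by the amphichirality of `S⁴`,
  `sphereReflection_isOrientationReversing_of_ne_zero`);
* Theorem A `mirrorSymmetricAt_of_pinned` — two pinned chains, from `(M, oM)` and from `(M, −oM)`, give ℂℙ²-stable mirror symmetry;
* the glue: `ChiralityPinning` pins the bi-dissolution for `oM` and `−oM` at a common length, Theorem A gives mirror symmetry,
  `StableMirrorDescent` descends to `M ≅⁺ −M`.

Sorry-free; no new facts; axioms standard. -/

set_option linter.unusedVariables false
set_option linter.unusedSectionVars false
set_option linter.dupNamespace false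

open scoped Manifold ContDiff Topology ContinuousMap
open Set Module Function Filter

namespace Summit.SmoothPoincare4.SmoothPoincare4.Theorems.RootDecompNBiDissolvableAmphichiralMirrorSplit

open Literature.Topology.FourManifolds

/-! ## §1 Amphichirality of `S⁴` and of anything diffeomorphic to it -/

/-- `S⁴` is amphichiral: the hyperplane reflection reverses every orientation (tree: `sphereReflection_isOrientationReversing_of_ne_zero`). -/
theorem sphere_four_orientationReversing_self (oS : SmoothOrientation (𝓡 4) (Metric.sphere (0 : EuclideanSpace ℝ (Fin 5)) 1)) :
    ∃ ρ : (Metric.sphere (0 : EuclideanSpace ℝ (Fin 5)) 1) ≃ₘ⟮𝓡 4, 𝓡 4⟯ (Metric.sphere (0 : EuclideanSpace ℝ (Fin 5)) 1), ρ.IsOrientationPreserving oS (-oS) :=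
  ⟨sphereReflection (sphereBasePoint 4),
    (isOrientationReversing_iff oS oS _).mp
      (sphereReflection_isOrientationReversing_of_ne_zero (n := 4) (by norm_num) (sphereBasePoint 4) oS)⟩

/-- Amphichirality of a connected `M` transports along a diffeomorphism `M ≅ S⁴`. -/
theorem isAmphichiral_of_diffeomorph_sphere {M : Type} [TopologicalSpace M]
    [ChartedSpace (EuclideanSpace ℝ (Fin 4)) M] [IsManifold (𝓡 4) ∞ M] [ConnectedSpace M]
    (d : M ≃ₘ⟮𝓡 4, 𝓡 4⟯ (Metric.sphere (0 : EuclideanSpace ℝ (Fin 5)) 1)) (oM : SmoothOrientation (𝓡 4) M) :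
    ∃ ρ : M ≃ₘ⟮𝓡 4, 𝓡 4⟯ M, ρ.IsOrientationPreserving oM (-oM) := by
  obtain ⟨oS⟩ := isOrientable_of_homotopyEquiv_sphere_four_holds ((Metric.sphere (0 : EuclideanSpace ℝ (Fin 5)) 1)) (ContinuousMap.HomotopyEquiv.refl _)
  rcases Diffeomorph.isOrientationPreserving_or_isOrientationReversing_holds d (by simp) oM oS
    with hd | hd
  · obtain ⟨r, hr⟩ := sphere_four_orientationReversing_self oS
    have h1 : (d.trans r).IsOrientationPreserving oM (-oS) :=
      Diffeomorph.IsOrientationPreserving.trans_holds hd hr (by simp)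
    have h2 : d.symm.IsOrientationPreserving (-oS) (-oM) :=
      (isOrientationPreserving_neg_neg_iff oS oM _).mpr
        (Diffeomorph.IsOrientationPreserving.symm_holds hd (by simp))
    exact ⟨(d.trans r).trans d.symm, Diffeomorph.IsOrientationPreserving.trans_holds h1 h2 (by simp)⟩
  · obtain ⟨r, hr⟩ := sphere_four_orientationReversing_self (-oS)
    have hr' : r.IsOrientationPreserving (-oS) oS := by
      have h := hr
      rwa [neg_neg] at h
    have hd' : d.IsOrientationPreserving oM (-oS) := hd
    have h1 : (d.trans r).IsOrientationPreserving oM oS :=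
      Diffeomorph.IsOrientationPreserving.trans_holds hd' hr' (by simp)
    have h2 : d.symm.IsOrientationPreserving oS (-oM) := by
      have h := (isOrientationPreserving_neg_neg_iff (-oS) oM _).mpr
        (Diffeomorph.IsOrientationPreserving.symm_holds hd' (by simp))
      rwa [neg_neg] at h
    exact ⟨(d.trans r).trans d.symm, Diffeomorph.IsOrientationPreserving.trans_holds h1 h2 (by simp)⟩

/-! ## §2 The KNOWN half, in kernel: uniqueness of oriented standard chains; mirror symmetry from two pinned chains -/

/-- **Theorem U (standard chains are unique).**  Two ORIENTED standard chains `Q`, `Q'` from `S⁴` with the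
same summands `(ℂℙ², c₀)` have orientation-preservingly diffeomorphic ends at every length.  Induction:
the base case is `Q 0 ≅ S⁴ ≅ Q' 0` corrected, if orientation-reversing, by an orientation-reversing
self-diffeomorphism of `Q' 0 ≅ S⁴` (`S⁴` is amphichiral); the step transports the sum
`(Q (k+1), oQ (k+1)) = (Q k, oQ k) # (ℂℙ², c₀)` along the inductive diffeomorphism
(`IsOrientedConnectedSum.of_diffeomorph_left`) and applies Kervaire–Milnor uniqueness
(`exists_diffeomorph_isOrientationPreserving_of_isOrientedConnectedSum_euclidean`); connectedness of the
`Q k` is carried along (`IsConnectedSum.connectedSpace_holds`). -/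
theorem stdChain_unique (c₀ : SmoothOrientation (𝓡 4) ComplexProjectivePlane)
    {Q Q' : ℕ → Type} [∀ i, TopologicalSpace (Q i)] [∀ i, T2Space (Q i)]
    [∀ i, ChartedSpace (EuclideanSpace ℝ (Fin 4)) (Q i)] [∀ i, IsManifold (𝓡 4) ∞ (Q i)]
    [∀ i, TopologicalSpace (Q' i)] [∀ i, T2Space (Q' i)]
    [∀ i, ChartedSpace (EuclideanSpace ℝ (Fin 4)) (Q' i)] [∀ i, IsManifold (𝓡 4) ∞ (Q' i)]
    (oQ : ∀ i, SmoothOrientation (𝓡 4) (Q i)) (oQ' : ∀ i, SmoothOrientation (𝓡 4) (Q' i))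
    (h0 : Nonempty (Q 0 ≃ₘ⟮𝓡 4, 𝓡 4⟯ (Metric.sphere (0 : EuclideanSpace ℝ (Fin 5)) 1))) (h0' : Nonempty (Q' 0 ≃ₘ⟮𝓡 4, 𝓡 4⟯ (Metric.sphere (0 : EuclideanSpace ℝ (Fin 5)) 1))) {n : ℕ}
    (hs : ∀ i < n, IsOrientedConnectedSum (oQ i) c₀ (oQ (i + 1)))
    (hs' : ∀ i < n, IsOrientedConnectedSum (oQ' i) c₀ (oQ' (i + 1))) :
    ∃ u : Q n ≃ₘ⟮𝓡 4, 𝓡 4⟯ Q' n, u.IsOrientationPreserving (oQ n) (oQ' n) := by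
  suffices main : ∀ k, k ≤ n → ConnectedSpace (Q k) ∧ ConnectedSpace (Q' k) ∧
      ∃ u : Q k ≃ₘ⟮𝓡 4, 𝓡 4⟯ Q' k, u.IsOrientationPreserving (oQ k) (oQ' k) from
    (main n le_rfl).2.2
  intro k
  induction k with
  | zero =>
    intro _
    obtain ⟨a⟩ := h0
    obtain ⟨b⟩ := h0'
    haveI := pathConnectedSpace_sphere_four
    have cQ : ConnectedSpace (Q 0) :=
      a.symm.surjective.connectedSpace a.symm.continuous
    have cQ' : ConnectedSpace (Q' 0) :=
      b.symm.surjective.connectedSpace b.symm.continuous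
    refine ⟨cQ, cQ', ?_⟩
    rcases Diffeomorph.isOrientationPreserving_or_isOrientationReversing_holds (a.trans b.symm)
        (by simp) (oQ 0) (oQ' 0) with h | h
    · exact ⟨a.trans b.symm, h⟩
    · obtain ⟨ρ, hρ⟩ := isAmphichiral_of_diffeomorph_sphere b (-oQ' 0)
      have hρ' : ρ.IsOrientationPreserving (-oQ' 0) (oQ' 0) := by
        have h' := hρ
        rwa [neg_neg] at h'
      have h'' : (a.trans b.symm).IsOrientationPreserving (oQ 0) (-oQ' 0) := h
      exact ⟨(a.trans b.symm).trans ρ, Diffeomorph.IsOrientationPreserving.trans_holds h'' hρ' (by simp)⟩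
  | succ k ih =>
    intro hk
    obtain ⟨cQ, cQ', u, hu⟩ := ih (Nat.le_of_succ_le hk)
    have hlt : k < n := hk
    have h1 := hs k hlt
    have h2 := hs' k hlt
    have h4 : 1 < finrank ℝ (EuclideanSpace ℝ (Fin 4)) := by
      rw [finrank_euclideanSpace_fin]; omega
    have cQ1 : ConnectedSpace (Q (k + 1)) :=
      IsConnectedSum.connectedSpace_holds h4 h1.isConnectedSum
    have cQ1' : ConnectedSpace (Q' (k + 1)) :=
      IsConnectedSum.connectedSpace_holds h4 h2.isConnectedSum
    obtain ⟨e, he⟩ :=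
      exists_diffeomorph_isOrientationPreserving_of_isOrientedConnectedSum_euclidean
        (h1.of_diffeomorph_left u hu) h2
    exact ⟨cQ1, cQ1', e, he⟩

/-- **Theorem A (mirror symmetry from two pinned chains).**  PINNED chains — an oriented blow-up chain `P` from `(M, oM)` resp.
from the mirror `(M, −oM)` with all summands `(ℂℙ², c₀)`, an oriented standard chain `Q` from `S⁴` with the same summands, and an
orientation-PRESERVING diffeomorphism of the ends — of the same length `n` give ℂℙ²-stable MIRROR SYMMETRY at `n`,
`(M, oM) # n(ℂℙ², c₀) ≅⁺ (M, −oM) # n(ℂℙ², c₀)`: compose `P n ≅⁺ Q n ≅⁺ Q' n ≅⁺ P' n`, the middle map by Theorem U.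
(The hypotheses are the born `ChiralityPinning` conclusion shape, the conclusion is the born `StableMirrorDescent` hypothesis shape.) -/
theorem mirrorSymmetricAt_of_pinned {M : Type} [TopologicalSpace M]
    [ChartedSpace (EuclideanSpace ℝ (Fin 4)) M] [IsManifold (𝓡 4) ∞ M]
    {oM : SmoothOrientation (𝓡 4) M} {c₀ : SmoothOrientation (𝓡 4) ComplexProjectivePlane} {n : ℕ}
    (h : ∃ (P Q : ℕ → Type) (_ : ∀ i, TopologicalSpace (P i)) (_ : ∀ i, T2Space (P i))
      (_ : ∀ i, SecondCountableTopology (P i)) (_ : ∀ i, ChartedSpace (EuclideanSpace ℝ (Fin 4)) (P i))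
      (_ : ∀ i, IsManifold (𝓡 4) ∞ (P i)) (_ : ∀ i, CompactSpace (P i))
      (_ : ∀ i, TopologicalSpace (Q i)) (_ : ∀ i, T2Space (Q i))
      (_ : ∀ i, SecondCountableTopology (Q i)) (_ : ∀ i, ChartedSpace (EuclideanSpace ℝ (Fin 4)) (Q i))
      (_ : ∀ i, IsManifold (𝓡 4) ∞ (Q i)) (_ : ∀ i, CompactSpace (Q i))
      (o : ∀ i, SmoothOrientation (𝓡 4) (P i)) (oQ : ∀ i, SmoothOrientation (𝓡 4) (Q i)),
      (∃ e : P 0 ≃ₘ⟮𝓡 4, 𝓡 4⟯ M, e.IsOrientationPreserving (o 0) oM) ∧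
      Nonempty (Q 0 ≃ₘ⟮𝓡 4, 𝓡 4⟯ (Metric.sphere (0 : EuclideanSpace ℝ (Fin 5)) 1)) ∧
      (∀ i < n, IsOrientedConnectedSum (o i) c₀ (o (i + 1))) ∧
      (∀ i < n, IsOrientedConnectedSum (oQ i) c₀ (oQ (i + 1))) ∧
      ∃ d : P n ≃ₘ⟮𝓡 4, 𝓡 4⟯ Q n, d.IsOrientationPreserving (o n) (oQ n))
    (h' : ∃ (P Q : ℕ → Type) (_ : ∀ i, TopologicalSpace (P i)) (_ : ∀ i, T2Space (P i))
      (_ : ∀ i, SecondCountableTopology (P i)) (_ : ∀ i, ChartedSpace (EuclideanSpace ℝ (Fin 4)) (P i))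
      (_ : ∀ i, IsManifold (𝓡 4) ∞ (P i)) (_ : ∀ i, CompactSpace (P i))
      (_ : ∀ i, TopologicalSpace (Q i)) (_ : ∀ i, T2Space (Q i))
      (_ : ∀ i, SecondCountableTopology (Q i)) (_ : ∀ i, ChartedSpace (EuclideanSpace ℝ (Fin 4)) (Q i))
      (_ : ∀ i, IsManifold (𝓡 4) ∞ (Q i)) (_ : ∀ i, CompactSpace (Q i))
      (o : ∀ i, SmoothOrientation (𝓡 4) (P i)) (oQ : ∀ i, SmoothOrientation (𝓡 4) (Q i)),
      (∃ e : P 0 ≃ₘ⟮𝓡 4, 𝓡 4⟯ M, e.IsOrientationPreserving (o 0) (-oM)) ∧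
      Nonempty (Q 0 ≃ₘ⟮𝓡 4, 𝓡 4⟯ (Metric.sphere (0 : EuclideanSpace ℝ (Fin 5)) 1)) ∧
      (∀ i < n, IsOrientedConnectedSum (o i) c₀ (o (i + 1))) ∧
      (∀ i < n, IsOrientedConnectedSum (oQ i) c₀ (oQ (i + 1))) ∧
      ∃ d : P n ≃ₘ⟮𝓡 4, 𝓡 4⟯ Q n, d.IsOrientationPreserving (o n) (oQ n)) :
    ∃ (P P' : ℕ → Type) (_ : ∀ i, TopologicalSpace (P i)) (_ : ∀ i, T2Space (P i))
      (_ : ∀ i, SecondCountableTopology (P i)) (_ : ∀ i, ChartedSpace (EuclideanSpace ℝ (Fin 4)) (P i))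
      (_ : ∀ i, IsManifold (𝓡 4) ∞ (P i)) (_ : ∀ i, CompactSpace (P i))
      (_ : ∀ i, TopologicalSpace (P' i)) (_ : ∀ i, T2Space (P' i))
      (_ : ∀ i, SecondCountableTopology (P' i)) (_ : ∀ i, ChartedSpace (EuclideanSpace ℝ (Fin 4)) (P' i))
      (_ : ∀ i, IsManifold (𝓡 4) ∞ (P' i)) (_ : ∀ i, CompactSpace (P' i))
      (o : ∀ i, SmoothOrientation (𝓡 4) (P i)) (o' : ∀ i, SmoothOrientation (𝓡 4) (P' i)),
      (∃ e : P 0 ≃ₘ⟮𝓡 4, 𝓡 4⟯ M, e.IsOrientationPreserving (o 0) oM) ∧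
      (∃ e' : P' 0 ≃ₘ⟮𝓡 4, 𝓡 4⟯ M, e'.IsOrientationPreserving (o' 0) (-oM)) ∧
      (∀ i < n, IsOrientedConnectedSum (o i) c₀ (o (i + 1))) ∧
      (∀ i < n, IsOrientedConnectedSum (o' i) c₀ (o' (i + 1))) ∧
      ∃ d : P n ≃ₘ⟮𝓡 4, 𝓡 4⟯ P' n, d.IsOrientationPreserving (o n) (o' n) := by
  obtain ⟨P, Q, a1, a2, a3, a4, a5, a6, b1, b2, b3, b4, b5, b6, o, oQ, he, hQ0, hP, hQ, ⟨d, hd⟩⟩ := h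
  obtain ⟨P', Q', a1', a2', a3', a4', a5', a6', b1', b2', b3', b4', b5', b6', o', oQ', he', hQ0', hP',
    hQ', ⟨d', hd'⟩⟩ := h'
  obtain ⟨u, hu⟩ := stdChain_unique c₀ oQ oQ' hQ0 hQ0' hQ hQ'
  refine ⟨P, P', a1, a2, a3, a4, a5, a6, a1', a2', a3', a4', a5', a6', o, o', he, he', hP, hP',
    (d.trans u).trans d'.symm, ?_⟩
  exact Diffeomorph.IsOrientationPreserving.trans_holds
    (Diffeomorph.IsOrientationPreserving.trans_holds hd hu (by simp))
    (Diffeomorph.IsOrientationPreserving.symm_holds hd' (by simp)) (by simp)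

/-! ## §3 THE SPLIT GLUE ITEM -/

/-- The split glue of route N at `BiDissolvableAmphichiral` holds outright: pin the bi-dissolution for `oM` and `−oM` at a
common length (`ChiralityPinning`), get mirror symmetry (Theorem A), descend (`StableMirrorDescent`). -/
theorem biDissolvableAmphichiralMirrorGlue_holds : Summit.SmoothPoincare4.SmoothPoincare4.Theses.RootDecompN.BiDissolvableAmphichiralMirrorGlue := by
  intro hPin hSMD M _ _ _ _ _ hM hbi oM
  obtain ⟨oC⟩ := (isOrientable_complexProjectivePlane_holds :
    IsOrientable (𝓡 4) ComplexProjectivePlane)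
  obtain ⟨n, -, hall⟩ := hPin M hM hbi oC
  exact hSMD M hM oM oC n (mirrorSymmetricAt_of_pinned (hall oM) (hall (-oM))) oM

end Summit.SmoothPoincare4.SmoothPoincare4.Theorems.RootDecompNBiDissolvableAmphichiralMirrorSplit
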